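import Literature.NumberTheory.Rogawski1990.LocalTransferExplicitNonsplit
import Literature.NumberTheory.Rogawski1990.LocalTransferGlueCM
import Literature.NumberTheory.Automorphic.OrbitalMeasureCanonical
import Literature.NumberTheory.Rogawski1990.LocalTransferGlueNhdsOne
import Literature.NumberTheory.Rogawski1990.UnitFundamentalLemmaExplicitNonsplitClosedProof
import Literature.NumberTheory.Automorphic.IntegralMatrixReduction
import Literature.NumberTheory.Rogawski1990.FinExplicitTransferFactorCayleyShiftSum          -- ★ p846531 (A3): the transport `finsum_finExplicitCollection_Δ_mul_eq_inv_sq_mul_finsum_shift`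
import Literature.NumberTheory.Rogawski1990.TypeOneCayleyShiftBindersCM                    -- ★ p846612 N1∕N4: `isUnit_shift_denominators_of_disc_lt`, `shifted_binders_of_typeOne`, `not_levi_of_shift`
import Literature.NumberTheory.Rogawski1990.TypeTwoCayleyShiftIntegralCM                    -- ★ γ₅: `charpoly_coeff_endoEmbLocal_mem_of_shifted` (+ γ₃ `shifted_binders_of_typeTwo`, `isUnit_shift_denominators_of_typeTwo`)
import Literature.NumberTheory.Rogawski1990.DepthZeroTransferHValuesShift                   -- ★ p846474 (END g15): the two `S`-rows, types (1)∕(2)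
import Literature.NumberTheory.Automorphic.UnitaryLevelOnePieceOfStrata                     -- ★ p846532: `exists_levelOne_piece_boundary` (the piece `g′`)
import Literature.NumberTheory.Automorphic.MatrixMoebiusShiftLevel                          -- ★ p846642 N5a: `valued_moebius_sub_one_le_of_level` + scalar twin
import Literature.NumberTheory.Rogawski1990.DepthZeroKappaTransferTypeTwoGSide              -- ★ p846592: `setOf_entrywise_deep_mem_nhds_one`, `valuation_quadratic_bounds_of_entrywise_deep`
import Literature.NumberTheory.Rogawski1990.FinExplicitTransferFactorInertExponentStub      -- ★ `exists_irredExponents_of_hint`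
import Literature.NumberTheory.Rogawski1990.FinExplicitTransferFactorInertExponentSplitStub -- ★ `exists_flicker_exponents_split`
import Literature.NumberTheory.Rogawski1990.UnitaryVertexStabilizerSpanCM                  -- ★ `setOf_residuallyUnipotent_endoEmbLocal_mem_nhds_one`, `v_charpoly_coeff_le_one_of_residuallyUnipotent`
import Literature.NumberTheory.Rogawski1990.FinExplicitTransferFactorResiduallyRegular      -- ★ `charpoly_map_endoEmbLocal_apply`
import Literature.NumberTheory.Automorphic.UnitaryCyclicCentralizerCompactNonsplit          -- ★ `compactSpace_centralizer_of_not_exists_isRoot`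
import Literature.NumberTheory.Automorphic.UnitaryTypeTwoNormPairCentralizerCompact         -- ★ `compactSpace_centralizer_of_isLocalNormPair_of_not_exists_isRoot`
import Literature.NumberTheory.Rogawski1990.LevelTwoLiftInteriorTypeOneCompact             -- ★ p846732 (F0P2-p02 g12): `compactSpace_centralizer_of_isLocalNormPair_of_isRoot`
import Literature.NumberTheory.Automorphic.LevelTwoInteriorOrbitalTransport               -- ★ p846692 (F0P2-p01 g14) N3: `classOrbitalIntegral_levelOneIndicator_eq_shift` (the `hF`)
import Literature.NumberTheory.Automorphic.UnitaryCarrierCongruenceNhdsBasis              -- ★ p846670 (F0P3a-p06 g14) N5b: `exists_level_forall_shift_mem_of_mem_nhds_one`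
import Literature.NumberTheory.Rogawski1990.LeviNearOneTwoDeep                              -- ★ p846644: `exists_nhds_one_twoDeep_endoEmbLocal`, `valued_sub_one_le_of_isRoot_charpoly_of_congr_one`
import Literature.NumberTheory.Rogawski1990.UnitFundamentalLemmaInertFlickerFrame           -- ★ `isUnit_two_integer_iff_valued_eq_one`
import Literature.NumberTheory.Rogawski1990.EndoscopicCentralizerIso                        -- ★ `isUnit_two_localRing`
import Literature.NumberTheory.Automorphic.NonsplitPlaceHaarBallRatios                      -- ★ `isUnit_toLocalRing_uniformizer`, `conjLocal_toLocalRing_uniformizer`, `valued_toLocalRing_uniformizer_apply`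
import HarnessLib

/-!
# ORGAN (I) «LIFT — INTERIOR HALF» of the level-2 lift (road «S3-tree», END fold `LocalTransferAtOneHyperspecialLevelTwo` socket `stub_liftInterior`):
# the Cayley∕Möbius shift `γ_H ↦ u_H` near `1 ∈ H_v`, its `S`-rows, and the transport `Σ_c Δ‴(γ_H,c)Φ(c, g_int) = q⁻²·Σ_c Δ‴(u_H,c)Φ(c, g′)`

Seat END F0P3a-p03 (g16), architect A-155.  The assembly consumes BY NAME: N3 ★ p846692 `classOrbitalIntegral_levelOneIndicator_eq_shift` (F0P2-p01 (g14)), N5b ★ p846670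
`exists_level_forall_shift_mem_of_mem_nhds_one` (F0P3a-p06 (g14)), the type-(1) compact-centraliser supplier ★ `compactSpace_centralizer_of_isLocalNormPair_of_isRoot`
(F0P2-p02 (g12)), N1∕N4 ★ p846612, N5a ★ p846642, γ₃∕γ₅ ★, the `S`-rows ★ p846474, (A3) ★ p846531, `g′` ★ p846532.
Topic `NumberTheory/Rogawski1990`; namespace `Literature.NumberTheory.Rogawski1990`.  THEOREMS ONLY.  Cell `pub/hodgecm-mathlib` (D-0151), crux H413 = `stmt-HodgeConjecture-24833`;
`--supports` lane.  HONEST LABEL: HC_CM is proved only modulo the 2 remaining named inputs (hLiu418 24832, h413 24833) until rung 0 closes; count-neutral.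
-/

set_option autoImplicit false

noncomputable section

open NumberField IsDedekindDomain MeasureTheory Measure Topology Filter Matrix Polynomial
open Literature.NumberTheory.Rogawski1990 Literature.NumberTheory.Automorphic Literature.NumberTheory.GaloisRepresentations
open Literature.NumberTheory.Automorphic.UnitaryGroup Literature.NumberTheory.Automorphic.IntegralReduction Literature.NumberTheory.Automorphic.MoebiusShift
open Literature.NumberTheory.NumberFields
open Literature.AlgebraicGeometry.ShimuraVarieties (unitaryGroup hermForm)
open scoped Matrix MatrixGroups Classical ValuativeRel WithZero

namespace Literature.NumberTheory.Rogawski1990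

/-! ## The organ -/

set_option maxHeartbeats 1600000 in
-- the socket statement and the two-branch assembly carry the large CM-place tokens; no search tactic runs long here
/-- **ORGAN I «LIFT — INTERIOR HALF»** (END fold `…HyperspecialLevelTwo` v3.5 :530 VERBATIM): given the interior values `c′` of a level-2 `K`-class piece `g`, the canonical
level-1 strata piece `g′` with values `c′` (★ `exists_levelOne_piece_boundary`) satisfies, for `γ_H` near `1` non-Levi `G`-regular, with `u_H :=` the Cayley∕Möbius shift of
`γ_H` (one step less deep, same torus, `u_H ∈ V′` as near as wanted — N5b): the two `S`-rows (★ p846474) and the transport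
`Σ_c Δ‴(γ_H,c)Φ(c, g_int) = q⁻²·Σ_c Δ‴(u_H,c)Φ(c, g′)` (★ (A3) p846531 with `hF` = N3); types (1)∕(2) by ★ `exists_isRoot_charpoly_iff_isSquare_disc`-free case split on a root.
[cite: Rogawski1990, §4.9 Prop. 4.9.1 p. 55; §4.3 p. 43] [cite: Kottwitz1986, §3] [cite: Laumon1995, Lemma (5.3.2) p. 136] -/
theorem liftInterior_of_levelTwo
    (L : Type) [Field L] [NumberField L] [IsCMField L] (H' : Matrix (Fin 3) (Fin 3) L) (μ : HeckeCharacter L)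
    {v : HeightOneSpectrum (𝓞 ↥(maximalRealSubfield L))}
    (hH' : (H'.map (cmConjRingHom L)).transpose = H') (w : PlacesOver L v)
    (hw : IsCMField.complexConj L • w.1 = w.1) (hv : Algebra.IsUnramifiedIn (𝓞 L) v.asIdeal)
    (hH'w : IsUnit (placeForm H' w.1)) (hH'i : hH'w.unit ∈ glInt 3 (w.1.adicCompletion L))
    (hμ : μ.IsUnramifiedAt w.1) (hμu : μ.IsUnitary)
    (hμω : ∀ x : ideleGroup ↥(maximalRealSubfield L), μ (AdeleRing.ideleBaseChange ↥(maximalRealSubfield L) L x) = quadraticHeckeCharCM L x)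
    (h2 : IsUnit (2 : 𝒪[w.1.adicCompletion L]))
    [MeasurableSpace ((cmDatum L 3 H').Local v)] [BorelSpace ((cmDatum L 3 H').Local v)]
    [∀ γ : ((cmDatum L 3 H').Local v), MeasurableSpace (((cmDatum L 3 H').Local v) ⧸ Subgroup.centralizer ({γ} : Set ((cmDatum L 3 H').Local v)))]
    [∀ γ : ((cmDatum L 3 H').Local v), BorelSpace (((cmDatum L 3 H').Local v) ⧸ Subgroup.centralizer ({γ} : Set ((cmDatum L 3 H').Local v)))]
    [MeasurableSpace ((cmDatum L 2 (Matrix.of fun i j : Fin 2 => if i.val + j.val + 1 = 2 then (1 : L) else 0)).Local v × (cmDatum L 1 (Matrix.of fun i j : Fin 1 => if i.val + j.val + 1 = 1 then (1 : L) else 0)).Local v)] [BorelSpace ((cmDatum L 2 (Matrix.of fun i j : Fin 2 => if i.val + j.val + 1 = 2 then (1 : L) else 0)).Local v × (cmDatum L 1 (Matrix.of fun i j : Fin 1 => if i.val + j.val + 1 = 1 then (1 : L) else 0)).Local v)]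
  [∀ a : (cmDatum L 2 (Matrix.of fun i j : Fin 2 => if i.val + j.val + 1 = 2 then (1 : L) else 0)).Local v × (cmDatum L 1 (Matrix.of fun i j : Fin 1 => if i.val + j.val + 1 = 1 then (1 : L) else 0)).Local v, MeasurableSpace (((cmDatum L 2 (Matrix.of fun i j : Fin 2 => if i.val + j.val + 1 = 2 then (1 : L) else 0)).Local v × (cmDatum L 1 (Matrix.of fun i j : Fin 1 => if i.val + j.val + 1 = 1 then (1 : L) else 0)).Local v) ⧸ Subgroup.centralizer ({a} : Set ((cmDatum L 2 (Matrix.of fun i j : Fin 2 => if i.val + j.val + 1 = 2 then (1 : L) else 0)).Local v × (cmDatum L 1 (Matrix.of fun i j : Fin 1 => if i.val + j.val + 1 = 1 then (1 : L) else 0)).Local v)))]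
  [∀ a : (cmDatum L 2 (Matrix.of fun i j : Fin 2 => if i.val + j.val + 1 = 2 then (1 : L) else 0)).Local v × (cmDatum L 1 (Matrix.of fun i j : Fin 1 => if i.val + j.val + 1 = 1 then (1 : L) else 0)).Local v, BorelSpace (((cmDatum L 2 (Matrix.of fun i j : Fin 2 => if i.val + j.val + 1 = 2 then (1 : L) else 0)).Local v × (cmDatum L 1 (Matrix.of fun i j : Fin 1 => if i.val + j.val + 1 = 1 then (1 : L) else 0)).Local v) ⧸ Subgroup.centralizer ({a} : Set ((cmDatum L 2 (Matrix.of fun i j : Fin 2 => if i.val + j.val + 1 = 2 then (1 : L) else 0)).Local v × (cmDatum L 1 (Matrix.of fun i j : Fin 1 => if i.val + j.val + 1 = 1 then (1 : L) else 0)).Local v)))]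
    (νH : Measure ((cmDatum L 2 (Matrix.of fun i j : Fin 2 => if i.val + j.val + 1 = 2 then (1 : L) else 0)).Local v × (cmDatum L 1 (Matrix.of fun i j : Fin 1 => if i.val + j.val + 1 = 1 then (1 : L) else 0)).Local v)) [νH.IsHaarMeasure] [νH.IsMulRightInvariant]
    (νG : Measure ((cmDatum L 3 H').Local v)) [νG.IsHaarMeasure] [νG.IsMulRightInvariant]
    {mH : OrbitalMeasureFamily ((cmDatum L 2 (Matrix.of fun i j : Fin 2 => if i.val + j.val + 1 = 2 then (1 : L) else 0)).Local v × (cmDatum L 1 (Matrix.of fun i j : Fin 1 => if i.val + j.val + 1 = 1 then (1 : L) else 0)).Local v)} {mG : OrbitalMeasureFamily ((cmDatum L 3 H').Local v)}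
    (hmH : mH.IsCanonical (IsLocalGRegular L v) νH)
    (hmG : mG.IsCanonical (fun γ => IsRegularElt (γ.val : GL (Fin 3) (UnitaryGroup.LocalRing L v))) νG)
    (g : ((cmDatum L 3 H').Local v) → ℂ) (hg : IsLocSmooth g) (hgK : tsupport g ⊆ (cmLocalIntegralLevel L 3 H' v : Set ((cmDatum L 3 H').Local v)))
    (hginv : ∀ u ∈ cmLocalIntegralLevel L 3 H' v, ∀ x, g (u * x * u⁻¹) = g x)
    (hg2 : ∀ u : (cmDatum L 3 H').Local v,
      (∀ a b, Valued.v (((toPlace v w (HeckeCharacter.uniformizer ↥(maximalRealSubfield L) v : v.adicCompletion ↥(maximalRealSubfield L))) ^ 2)⁻¹ *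
        ((((localNonsplitEquiv (IsCMField.complexConj L) H' (IsCMField.complexConj_ne_one L) w hw u :
            ↥(unitaryGroupOfForm (galAdicCompletionMap (L := L) (IsCMField.complexConj L) hw) (placeForm H' w.1))) : GL (Fin 3) (w.1.adicCompletion L)) :
              Matrix (Fin 3) (Fin 3) (w.1.adicCompletion L)) a b - (1 : Matrix (Fin 3) (Fin 3) (w.1.adicCompletion L)) a b)) ≤ 1) →
      ∀ x, g (u * x) = g x)
    (c' : ℕ → ℂ) (hc' : ((∀ x : ((cmDatum L 3 H').Local v), (x ∈ cmLocalIntegralLevel L 3 H' v ∧ (∀ a b, Valued.v (((toPlace v w (HeckeCharacter.uniformizer ↥(maximalRealSubfield L) v : v.adicCompletion ↥(maximalRealSubfield L))) ^ 1)⁻¹ *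
        ((((localNonsplitEquiv (IsCMField.complexConj L) H' (IsCMField.complexConj_ne_one L) w hw (x) :
            ↥(unitaryGroupOfForm (galAdicCompletionMap (L := L) (IsCMField.complexConj L) hw) (placeForm H' w.1))) : GL (Fin 3) (w.1.adicCompletion L)) :
              Matrix (Fin 3) (Fin 3) (w.1.adicCompletion L)) a b - (1 : Matrix (Fin 3) (Fin 3) (w.1.adicCompletion L)) a b)) ≤ 1) ∧
        (redMat ((toPlace v w (HeckeCharacter.uniformizer ↥(maximalRealSubfield L) v : v.adicCompletion ↥(maximalRealSubfield L)))⁻¹ • ((((x).val : GL (Fin 3) (UnitaryGroup.LocalRing L v)).val.map (Pi.evalRingHom (fun w' : PlacesOver L v => w'.1.adicCompletion L) w)) - 1))) ^ 3 = 0 ∧ (redMat ((toPlace v w (HeckeCharacter.uniformizer ↥(maximalRealSubfield L) v : v.adicCompletion ↥(maximalRealSubfield L)))⁻¹ • ((((x).val : GL (Fin 3) (UnitaryGroup.LocalRing L v)).val.map (Pi.evalRingHom (fun w' : PlacesOver L v => w'.1.adicCompletion L) w)) - 1))).rank = 0) → g x = c' 0) ∧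
      (∀ x : ((cmDatum L 3 H').Local v), (x ∈ cmLocalIntegralLevel L 3 H' v ∧ (∀ a b, Valued.v (((toPlace v w (HeckeCharacter.uniformizer ↥(maximalRealSubfield L) v : v.adicCompletion ↥(maximalRealSubfield L))) ^ 1)⁻¹ *
        ((((localNonsplitEquiv (IsCMField.complexConj L) H' (IsCMField.complexConj_ne_one L) w hw (x) :
            ↥(unitaryGroupOfForm (galAdicCompletionMap (L := L) (IsCMField.complexConj L) hw) (placeForm H' w.1))) : GL (Fin 3) (w.1.adicCompletion L)) :
              Matrix (Fin 3) (Fin 3) (w.1.adicCompletion L)) a b - (1 : Matrix (Fin 3) (Fin 3) (w.1.adicCompletion L)) a b)) ≤ 1) ∧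
        (redMat ((toPlace v w (HeckeCharacter.uniformizer ↥(maximalRealSubfield L) v : v.adicCompletion ↥(maximalRealSubfield L)))⁻¹ • ((((x).val : GL (Fin 3) (UnitaryGroup.LocalRing L v)).val.map (Pi.evalRingHom (fun w' : PlacesOver L v => w'.1.adicCompletion L) w)) - 1))) ^ 3 = 0 ∧ (redMat ((toPlace v w (HeckeCharacter.uniformizer ↥(maximalRealSubfield L) v : v.adicCompletion ↥(maximalRealSubfield L)))⁻¹ • ((((x).val : GL (Fin 3) (UnitaryGroup.LocalRing L v)).val.map (Pi.evalRingHom (fun w' : PlacesOver L v => w'.1.adicCompletion L) w)) - 1))).rank = 1) → g x = c' 1) ∧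
      (∀ x : ((cmDatum L 3 H').Local v), (x ∈ cmLocalIntegralLevel L 3 H' v ∧ (∀ a b, Valued.v (((toPlace v w (HeckeCharacter.uniformizer ↥(maximalRealSubfield L) v : v.adicCompletion ↥(maximalRealSubfield L))) ^ 1)⁻¹ *
        ((((localNonsplitEquiv (IsCMField.complexConj L) H' (IsCMField.complexConj_ne_one L) w hw (x) :
            ↥(unitaryGroupOfForm (galAdicCompletionMap (L := L) (IsCMField.complexConj L) hw) (placeForm H' w.1))) : GL (Fin 3) (w.1.adicCompletion L)) :
              Matrix (Fin 3) (Fin 3) (w.1.adicCompletion L)) a b - (1 : Matrix (Fin 3) (Fin 3) (w.1.adicCompletion L)) a b)) ≤ 1) ∧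
        (redMat ((toPlace v w (HeckeCharacter.uniformizer ↥(maximalRealSubfield L) v : v.adicCompletion ↥(maximalRealSubfield L)))⁻¹ • ((((x).val : GL (Fin 3) (UnitaryGroup.LocalRing L v)).val.map (Pi.evalRingHom (fun w' : PlacesOver L v => w'.1.adicCompletion L) w)) - 1))) ^ 3 = 0 ∧ (redMat ((toPlace v w (HeckeCharacter.uniformizer ↥(maximalRealSubfield L) v : v.adicCompletion ↥(maximalRealSubfield L)))⁻¹ • ((((x).val : GL (Fin 3) (UnitaryGroup.LocalRing L v)).val.map (Pi.evalRingHom (fun w' : PlacesOver L v => w'.1.adicCompletion L) w)) - 1))).rank = 2) → g x = c' 2))) :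
    ∃ g' : ((cmDatum L 3 H').Local v) → ℂ, IsLocSmooth g' ∧ tsupport g' ⊆ (cmLocalIntegralLevel L 3 H' v : Set ((cmDatum L 3 H').Local v)) ∧
      (∀ u ∈ cmLocalIntegralLevel L 3 H' v, ∀ x, g' (u * x * u⁻¹) = g' x) ∧
      (∀ k ∈ cmLocalIntegralLevel L 3 H' v,
        (redMat (((k).val : GL (Fin 3) (UnitaryGroup.LocalRing L v)).val.map (Pi.evalRingHom (fun w' : PlacesOver L v => w'.1.adicCompletion L) w)) - 1) ^ 3 = 0 →
        g' k = c' (redMat (((k).val : GL (Fin 3) (UnitaryGroup.LocalRing L v)).val.map (Pi.evalRingHom (fun w' : PlacesOver L v => w'.1.adicCompletion L) w)) - 1).rank) ∧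
      ∀ V' ∈ 𝓝 (1 : ((cmDatum L 2 (Matrix.of fun i j : Fin 2 => if i.val + j.val + 1 = 2 then (1 : L) else 0)).Local v × (cmDatum L 1 (Matrix.of fun i j : Fin 1 => if i.val + j.val + 1 = 1 then (1 : L) else 0)).Local v)), ∃ V ∈ 𝓝 (1 : ((cmDatum L 2 (Matrix.of fun i j : Fin 2 => if i.val + j.val + 1 = 2 then (1 : L) else 0)).Local v × (cmDatum L 1 (Matrix.of fun i j : Fin 1 => if i.val + j.val + 1 = 1 then (1 : L) else 0)).Local v)), ∀ γH ∈ V, IsLocalGRegular L v γH →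
        ¬ (∃ (y : ((cmDatum L 2 (Matrix.of fun i j : Fin 2 => if i.val + j.val + 1 = 2 then (1 : L) else 0)).Local v × (cmDatum L 1 (Matrix.of fun i j : Fin 1 => if i.val + j.val + 1 = 1 then (1 : L) else 0)).Local v)) (d' : Fin 2 → (UnitaryGroup.LocalRing L v)ˣ),
          glDiagonal 2 (UnitaryGroup.LocalRing L v) d' = ((y * γH * y⁻¹).1.val : GL (Fin 2) (UnitaryGroup.LocalRing L v))) →
        ∃ uH ∈ V', IsLocalGRegular L v uH ∧
          stableOrbitalIntegralRel (IsLocalStablyConjH L v) mH (((((cmLocalIntegralLevel L 2 (Matrix.of fun i j : Fin 2 => if i.val + j.val + 1 = 2 then (1 : L) else 0) v).prod (cmLocalIntegralLevel L 1 (Matrix.of fun i j : Fin 1 => if i.val + j.val + 1 = 1 then (1 : L) else 0) v)) : Subgroup ((cmDatum L 2 (Matrix.of fun i j : Fin 2 => if i.val + j.val + 1 = 2 then (1 : L) else 0)).Local v × (cmDatum L 1 (Matrix.of fun i j : Fin 1 => if i.val + j.val + 1 = 1 then (1 : L) else 0)).Local v)) : Set ((cmDatum L 2 (Matrix.of fun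 i j : Fin 2 => if i.val + j.val + 1 = 2 then (1 : L) else 0)).Local v × (cmDatum L 1 (Matrix.of fun i j : Fin 1 => if i.val + j.val + 1 = 1 then (1 : L) else 0)).Local v)).indicator fun h => if (redMat (((h).1.val : GL (Fin 2) (UnitaryGroup.LocalRing L v)).val.map (Pi.evalRingHom (fun w' : PlacesOver L v => w'.1.adicCompletion L) w)) - 1) ^ 2 = 0 ∧ (redMat (((h).1.val : GL (Fin 2) (UnitaryGroup.LocalRing L v)).val.map (Pi.evalRingHom (fun w' : PlacesOver L v => w'.1.adicCompletion L) w)) - 1).rank = 0 then (1 : ℂ) else 0) uH =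
            stableOrbitalIntegralRel (IsLocalStablyConjH L v) mH (((((cmLocalIntegralLevel L 2 (Matrix.of fun i j : Fin 2 => if i.val + j.val + 1 = 2 then (1 : L) else 0) v).prod (cmLocalIntegralLevel L 1 (Matrix.of fun i j : Fin 1 => if i.val + j.val + 1 = 1 then (1 : L) else 0) v)) : Subgroup ((cmDatum L 2 (Matrix.of fun i j : Fin 2 => if i.val + j.val + 1 = 2 then (1 : L) else 0)).Local v × (cmDatum L 1 (Matrix.of fun i j : Fin 1 => if i.val + j.val + 1 = 1 then (1 : L) else 0)).Local v)) : Set ((cmDatum L 2 (Matrix.of fun i j : Fin 2 => if i.val + j.val + 1 = 2 then (1 : L) else 0)).Local v × (cmDatum L 1 (Matrix.of fun i j : Fin 1 => if i.val + j.val + 1 = 1 then (1 : L) else 0)).Local v)).indicator fun h => if (redMat (((h).1.val : GL (Fin 2) (UnitaryGroup.LocalRing L v)).val.map (Pi.evalRingHom (fun w' : PlacesOver L v => w'.1.adicCompletion L) w)) - 1) ^ 2 = 0 ∧ (redMat (((h).1.val : GL (Fin 2) (UnitaryGroup.LocalRing L v)).val.map (Pi.evalRingHom (fun w' : PlacesOver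 L v => w'.1.adicCompletion L) w)) - 1).rank = 0 then (1 : ℂ) else 0) γH -
              ((Ideal.absNorm v.asIdeal : ℕ) : ℂ)⁻¹ * stableOrbitalIntegralRel (IsLocalStablyConjH L v) mH (((((cmLocalIntegralLevel L 2 (Matrix.of fun i j : Fin 2 => if i.val + j.val + 1 = 2 then (1 : L) else 0) v).prod (cmLocalIntegralLevel L 1 (Matrix.of fun i j : Fin 1 => if i.val + j.val + 1 = 1 then (1 : L) else 0) v)) : Subgroup ((cmDatum L 2 (Matrix.of fun i j : Fin 2 => if i.val + j.val + 1 = 2 then (1 : L) else 0)).Local v × (cmDatum L 1 (Matrix.of fun i j : Fin 1 => if i.val + j.val + 1 = 1 then (1 : L) else 0)).Local v)) : Set ((cmDatum L 2 (Matrix.of fun i j : Fin 2 => if i.val + j.val + 1 = 2 then (1 : L) else 0)).Local v × (cmDatum L 1 (Matrix.of fun i j : Fin 1 => if i.val + j.val + 1 = 1 then (1 : L) else 0)).Local v)).indicator fun h => if (redMat (((h).1.val : GL (Fin 2) (UnitaryGroup.LocalRing L v)).val.map (Pi.evalRingHom (fun w' : PlacesOver L v => w'.1.adicCompletion L) w))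 - 1) ^ 2 = 0 ∧ (redMat (((h).1.val : GL (Fin 2) (UnitaryGroup.LocalRing L v)).val.map (Pi.evalRingHom (fun w' : PlacesOver L v => w'.1.adicCompletion L) w)) - 1).rank = 1 then (1 : ℂ) else 0) γH ∧
          stableOrbitalIntegralRel (IsLocalStablyConjH L v) mH (((((cmLocalIntegralLevel L 2 (Matrix.of fun i j : Fin 2 => if i.val + j.val + 1 = 2 then (1 : L) else 0) v).prod (cmLocalIntegralLevel L 1 (Matrix.of fun i j : Fin 1 => if i.val + j.val + 1 = 1 then (1 : L) else 0) v)) : Subgroup ((cmDatum L 2 (Matrix.of fun i j : Fin 2 => if i.val + j.val + 1 = 2 then (1 : L) else 0)).Local v × (cmDatum L 1 (Matrix.of fun i j : Fin 1 => if i.val + j.val + 1 = 1 then (1 : L) else 0)).Local v)) : Set ((cmDatum L 2 (Matrix.of fun i j : Fin 2 => if i.val + j.val + 1 = 2 then (1 : L) else 0)).Local v × (cmDatum L 1 (Matrix.of fun i j : Fin 1 => if i.val + j.val + 1 = 1 then (1 : L) else 0)).Local v)).indicator fun h => if (redMat (((h).1.val : GL (Fin 2) (UnitaryGroup.LocalRing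 L v)).val.map (Pi.evalRingHom (fun w' : PlacesOver L v => w'.1.adicCompletion L) w)) - 1) ^ 2 = 0 ∧ (redMat (((h).1.val : GL (Fin 2) (UnitaryGroup.LocalRing L v)).val.map (Pi.evalRingHom (fun w' : PlacesOver L v => w'.1.adicCompletion L) w)) - 1).rank = 1 then (1 : ℂ) else 0) uH =
            ((Ideal.absNorm v.asIdeal : ℕ) : ℂ)⁻¹ * stableOrbitalIntegralRel (IsLocalStablyConjH L v) mH (((((cmLocalIntegralLevel L 2 (Matrix.of fun i j : Fin 2 => if i.val + j.val + 1 = 2 then (1 : L) else 0) v).prod (cmLocalIntegralLevel L 1 (Matrix.of fun i j : Fin 1 => if i.val + j.val + 1 = 1 then (1 : L) else 0) v)) : Subgroup ((cmDatum L 2 (Matrix.of fun i j : Fin 2 => if i.val + j.val + 1 = 2 then (1 : L) else 0)).Local v × (cmDatum L 1 (Matrix.of fun i j : Fin 1 => if i.val + j.val + 1 = 1 then (1 : L) else 0)).Local v)) : Set ((cmDatum L 2 (Matrix.of fun i j : Fin 2 => if i.val + j.val + 1 = 2 then (1 : L) else 0)).Local v × (cmDatum L 1 (Matrix.of fun i j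 : Fin 1 => if i.val + j.val + 1 = 1 then (1 : L) else 0)).Local v)).indicator fun h => if (redMat (((h).1.val : GL (Fin 2) (UnitaryGroup.LocalRing L v)).val.map (Pi.evalRingHom (fun w' : PlacesOver L v => w'.1.adicCompletion L) w)) - 1) ^ 2 = 0 ∧ (redMat (((h).1.val : GL (Fin 2) (UnitaryGroup.LocalRing L v)).val.map (Pi.evalRingHom (fun w' : PlacesOver L v => w'.1.adicCompletion L) w)) - 1).rank = 1 then (1 : ℂ) else 0) γH ∧
          (∑ᶠ cG : ConjClasses ((cmDatum L 3 H').Local v),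
            ((finExplicitCollection L H' μ (finExplicitDelta_conj_left_all L H' μ) (finExplicitDelta_conj_right_all L H' μ)) v).Δ γH (Quotient.out cG) *
              classOrbitalIntegral mG ({x : (cmDatum L 3 H').Local v | (∀ a b, Valued.v (((toPlace v w (HeckeCharacter.uniformizer ↥(maximalRealSubfield L) v : v.adicCompletion ↥(maximalRealSubfield L))) ^ 1)⁻¹ *
        ((((localNonsplitEquiv (IsCMField.complexConj L) H' (IsCMField.complexConj_ne_one L) w hw (x) :
            ↥(unitaryGroupOfForm (galAdicCompletionMap (L := L) (IsCMField.complexConj L) hw) (placeForm H' w.1))) : GL (Fin 3) (w.1.adicCompletion L)) :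
              Matrix (Fin 3) (Fin 3) (w.1.adicCompletion L)) a b - (1 : Matrix (Fin 3) (Fin 3) (w.1.adicCompletion L)) a b)) ≤ 1)}.indicator g) cG) =
            (((Ideal.absNorm v.asIdeal : ℕ) : ℂ) ^ 2)⁻¹ *
            (∑ᶠ cG : ConjClasses ((cmDatum L 3 H').Local v),
            ((finExplicitCollection L H' μ (finExplicitDelta_conj_left_all L H' μ) (finExplicitDelta_conj_right_all L H' μ)) v).Δ uH (Quotient.out cG) *
              classOrbitalIntegral mG g' cG) := by
  have _hH'i := hH'i  -- binders of the socket text (END fold VERBATIM) not needed by the proof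
  have _hμu := hμu
  have _hg2 := hg2
  -- ───── constants of the place ─────
  have hsub : Subsingleton (PlacesOver L v) :=
    PlacesOver.subsingleton_of_smul_eq (IsCMField.complexConj L) (IsCMField.complexConj_ne_one L) w hw
  haveI := Literature.NumberTheory.Automorphic.isAdicComplete_maximalIdeal_valuedInteger_adicCompletion L w.1
  have hiso := ValuativeRel.isEquiv (ValuativeRel.valuation (w.1.adicCompletion L))
    (Valued.v : Valuation (w.1.adicCompletion L) (WithZero (Multiplicative ℤ)))
  have hH'u : IsUnit H' := by
    rw [Matrix.isUnit_iff_isUnit_det]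
    have h := (Matrix.isUnit_iff_isUnit_det _).1 hH'w
    rw [show placeForm H' w.1 = (algebraMap L (w.1.adicCompletion L)).mapMatrix H' from rfl, ← RingHom.map_det] at h
    exact isUnit_iff_ne_zero.2 fun h0 => h.ne_zero (by rw [h0, map_zero])
  have hdetH : H'.det ≠ 0 := fun h0 => by
    rw [Matrix.isUnit_iff_isUnit_det, h0] at hH'u; exact not_isUnit_zero hH'u
  have h2w : Valued.v (2 : w.1.adicCompletion L) = 1 := (isUnit_two_integer_iff_valued_eq_one L w.1).1 h2
  have h2V : IsUnit (2 : Valued.integer (w.1.adicCompletion L)) := by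
    have h := (Valuation.Integers.isUnit_iff_valuation_eq_one (Valuation.integer.integers _)).1 h2
    rw [Valuation.Integers.isUnit_iff_valuation_eq_one (Valuation.integer.integers _)]
    rw [map_ofNat] at h ⊢
    exact (hiso.eq_one_iff_eq_one).1 h
  haveI : NeZero (2 : w.1.adicCompletion L) := ⟨fun h => by rw [h, map_zero] at h2w; exact zero_ne_one h2w⟩
  -- the shift parameter `c = ι_v(ϖ_v)`
  obtain ⟨c, hcdef⟩ : ∃ c : LocalRing L v, c = (((isUnit_toLocalRing_uniformizer L v).unit : (LocalRing L v)ˣ) : LocalRing L v) := ⟨_, rfl⟩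
  have hσc : conjLocal L (IsCMField.complexConj L) v c = c := by rw [hcdef]; exact conjLocal_toLocalRing_uniformizer L v
  have hc : Valued.v (c w) = WithZero.exp (-1 : ℤ) := by rw [hcdef]; exact valued_toLocalRing_uniformizer_apply L v w hv
  have hcw : c w = toPlace v w (HeckeCharacter.uniformizer ↥(maximalRealSubfield L) v : v.adicCompletion ↥(maximalRealSubfield L)) := by
    rw [hcdef, IsUnit.unit_spec, toLocalRing_apply]
  have hc0 : c w ≠ 0 := fun h0 => by rw [h0, map_zero] at hc; exact WithZero.zero_ne_coe hc
  have hcc0 : c w ^ 2 ≠ 0 := pow_ne_zero _ hc0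
  have hcc : Valued.v (c w ^ 2) = WithZero.exp (-2 : ℤ) := by
    rw [map_pow, hc, ← WithZero.exp_nsmul]; norm_num
  have h4c : IsUnit ((c + 1) ^ 2 - (c - 1) ^ 2) := by
    rw [show (c + 1) ^ 2 - (c - 1) ^ 2 = 2 * 2 * c by ring]
    exact ((isUnit_two_localRing L v).mul (isUnit_two_localRing L v)).mul (hcdef ▸ Units.isUnit _)
  have hem1 : WithZero.exp (-2 : ℤ) ≤ WithZero.exp (-1 : ℤ) := WithZero.exp_le_exp.2 (by norm_num)
  have he1 : WithZero.exp (-1 : ℤ) < 1 := by rw [← WithZero.exp_zero, WithZero.exp_lt_exp]; norm_num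
  have he2 : WithZero.exp (-2 : ℤ) < 1 := lt_of_le_of_lt hem1 he1
  -- ───── the piece `g′` (★ p846532) ─────
  have Hob1 := exists_levelOne_piece_boundary L H' w hw hv c'
  obtain ⟨g', hg's, hg'K, hg'inv, -, hg'c⟩ := Hob1
  refine ⟨g', hg's, hg'K, hg'inv, hg'c, ?_⟩
  intro V' hV'
  -- ───── N5b: the shift lands in `V′` ─────
  have Hob2 := exists_level_forall_shift_mem_of_mem_nhds_one L w hw hc h2w hV'
  obtain ⟨j, hj, H5⟩ := Hob2
  -- ───── the neighbourhood `V` ─────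
  have Hob3 := exists_nhds_one_twoDeep_endoEmbLocal L v w
  obtain ⟨Vι, hVι, Hι⟩ := Hob3
  refine ⟨_ ∩ (_ ∩ (_ ∩ Vι)), Filter.inter_mem (setOf_entrywise_deep_mem_nhds_one L v w (pow_ne_zero (j + 1) hc0))
    (Filter.inter_mem (setOf_entrywise_deep_mem_nhds_one L v w hcc0)
    (Filter.inter_mem (setOf_residuallyUnipotent_endoEmbLocal_mem_nhds_one L v w) hVι)), ?_⟩
  rintro γH ⟨hγ5, hγ2, hγ0, hγι⟩ hreg hnl
  simp only [Set.mem_setOf_eq] at hγ5 hγ2 hγ0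
  obtain ⟨hgj, huj⟩ := hγ5
  have hgj' : ∀ i k, Valued.v (((((γH.1.val : GL (Fin 2) (LocalRing L v)).val : Matrix (Fin 2) (Fin 2) (LocalRing L v))).map
      (Pi.evalRingHom (fun w' : UnitaryGroup.PlacesOver L v => w'.1.adicCompletion L) w) - 1) i k) ≤ Valued.v (c w) ^ (j + 1) := fun i k => by
    rw [← map_pow]; exact hgj i k
  have huj' : Valued.v (finGammaTwo L v γH w - 1) ≤ Valued.v (c w) ^ (j + 1) := by rw [← map_pow]; exact huj
  have Hob4 := hγ2
  obtain ⟨hg2w, hu2w⟩ := Hob4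
  have hdeepι := Hι γH hγι
  -- level-1 and level-2 bounds in the three currencies
  have hg2c : ∀ i j, Valued.v (((((γH.1.val : GL (Fin 2) (LocalRing L v)).val.map (Pi.evalRingHom (fun w' : PlacesOver L v => w'.1.adicCompletion L) w))) - 1) i j) ≤ Valued.v (c w) ^ (1 + 1) := fun i j => by
    rw [← map_pow]; exact hg2w i j
  have hu2c : Valued.v (finGammaTwo L v γH w - 1) ≤ Valued.v (c w) ^ (1 + 1) := by rw [← map_pow]; exact hu2w
  have hg1 : ∀ i j, Valued.v (((((γH.1.val : GL (Fin 2) (LocalRing L v)).val.map (Pi.evalRingHom (fun w' : PlacesOver L v => w'.1.adicCompletion L) w))) - 1) i j) ≤ Valued.v (c w) := fun i j =>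
    (hg2w i j).trans (by rw [hcc, hc]; exact hem1)
  have hu1 : Valued.v (finGammaTwo L v γH w - 1) ≤ Valued.v (c w) := hu2w.trans (by rw [hcc, hc]; exact hem1)
  have hg1e : ∀ i j, Valued.v (((((γH.1.val : GL (Fin 2) (LocalRing L v)).val.map (Pi.evalRingHom (fun w' : PlacesOver L v => w'.1.adicCompletion L) w))) - 1) i j) ≤ WithZero.exp (-1 : ℤ) := fun i j => by rw [← hc]; exact hg1 i j
  have hu1e : Valued.v (finGammaTwo L v γH w - 1) ≤ WithZero.exp (-1 : ℤ) := by rw [← hc]; exact hu1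
  have hdeepN3 : ∀ i j, Valued.v (((((endoEmbLocal L v γH).val : GL (Fin 3) (LocalRing L v)).val.map
      (Pi.evalRingHom (fun w' : UnitaryGroup.PlacesOver L v => w'.1.adicCompletion L) w)) - 1) i j) ≤ Valued.v (c w) ^ 2 := fun i j => by
    rw [← map_pow, hcc]; exact hdeepι i j
  -- integrality of `charpoly(ι_v γ_H)_w` in both currencies
  have hintV : ∀ i : ℕ, ((((endoEmbLocal L v γH).val : GL (Fin 3) (UnitaryGroup.LocalRing L v)).val.map
      (Pi.evalRingHom (fun w' : PlacesOver L v => w'.1.adicCompletion L) w)).charpoly.coeff i) ∈ Valued.integer (w.1.adicCompletion L) :=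
    fun i => (Valuation.mem_integer_iff _ _).2 (v_charpoly_coeff_le_one_of_residuallyUnipotent _ hγ0 i)
  have hint : ∀ i : ℕ, ((((endoEmbLocal L v γH).val : GL (Fin 3) (LocalRing L v)).val.map
      (Pi.evalRingHom (fun w' : PlacesOver L v => w'.1.adicCompletion L) w)).charpoly.coeff i) ∈ 𝒪[w.1.adicCompletion L] :=
    fun i => (Valuation.mem_integer_iff _ _).2 ((hiso.le_one_iff_le_one).2 ((Valuation.mem_integer_iff _ _).1 (hintV i)))
  -- the 3 × 3 numerator determinant of the shift is a unit as soon as the blocks' are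
  have hN3_of :
      IsUnit ((((c + 1) • ((γH.1.val : GL (Fin 2) (LocalRing L v)).val : Matrix (Fin 2) (Fin 2) (LocalRing L v)) + (c - 1) • (1 : Matrix (Fin 2) (Fin 2) (LocalRing L v))).det)) →
      IsUnit ((((c + 1) • ((γH.2.val : GL (Fin 1) (LocalRing L v)).val : Matrix (Fin 1) (Fin 1) (LocalRing L v)) + (c - 1) • (1 : Matrix (Fin 1) (Fin 1) (LocalRing L v))).det)) →
      IsUnit ((c + 1) • (((endoEmbLocal L v γH).val : GL (Fin 3) (LocalRing L v)).val : Matrix (Fin 3) (Fin 3) (LocalRing L v)) +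
        (c - 1) • (1 : Matrix (Fin 3) (Fin 3) (LocalRing L v))).det := fun hU2p hU1p' => by
    rw [coe_endoEmbLocal, coe_endoGL, smul_reindex_add_smul_one, smul_fromBlocks_add_smul_one, Matrix.det_reindex_self,
      Matrix.det_fromBlocks_zero₁₂]
    exact hU2p.mul hU1p'
  -- `χ(u)` read on the one-place model
  have hev : ∀ (γ : ((cmDatum L 2 (Matrix.of fun i j : Fin 2 => if i.val + j.val + 1 = 2 then (1 : L) else 0)).Local v × (cmDatum L 1 (Matrix.of fun i j : Fin 1 => if i.val + j.val + 1 = 1 then (1 : L) else 0)).Local v)),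
      ((finCharpolyTwo L v γ).eval (finGammaTwo L v γ)) w =
        ((γ.1.val : GL (Fin 2) (LocalRing L v)).val.map (Pi.evalRingHom (fun w' : PlacesOver L v => w'.1.adicCompletion L) w)).charpoly.eval (finGammaTwo L v γ w) := fun γ => by
    have e : ((finCharpolyTwo L v γ).eval (finGammaTwo L v γ)) w = (Pi.evalRingHom (fun w' : PlacesOver L v => w'.1.adicCompletion L) w) ((finCharpolyTwo L v γ).eval (finGammaTwo L v γ)) := rfl
    rw [e, ← Polynomial.eval₂_at_apply, ← Polynomial.eval_map, finCharpolyTwo, ← Matrix.charpoly_map]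
    rfl
  by_cases hroot : ∃ x : w.1.adicCompletion L, (((γH.1.val : GL (Fin 2) (UnitaryGroup.LocalRing L v)).val.map
      (Pi.evalRingHom (fun w' : PlacesOver L v => w'.1.adicCompletion L) w)).charpoly).IsRoot x
  · /- ───── TYPE (1): `χ_{g_w}` splits over `L_w` ───── -/
    have Hob5 := exists_flicker_exponents_split L v w hw hreg hintV hroot
    obtain ⟨α, γ, N₁, N₂, N, hα, hγ, hαγ, hN₁, hN₂, hN, -⟩ := Hob5
    have hcm : (((γH.1.val : GL (Fin 2) (LocalRing L v)).val.map (Pi.evalRingHom (fun w' : PlacesOver L v => w'.1.adicCompletion L) w))).charpoly = ((((γH.1.val : GL (Fin 2) (LocalRing L v)) : Matrix (Fin 2) (Fin 2) (LocalRing L v)).charpoly).map (Pi.evalRingHom (fun w' : PlacesOver L v => w'.1.adicCompletion L) w)) :=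
      Matrix.charpoly_map _ _
    have hαw : (((γH.1.val : GL (Fin 2) (LocalRing L v)).val.map (Pi.evalRingHom (fun w' : PlacesOver L v => w'.1.adicCompletion L) w))).charpoly.IsRoot α := by rw [hcm]; exact hα
    have hγw : (((γH.1.val : GL (Fin 2) (LocalRing L v)).val.map (Pi.evalRingHom (fun w' : PlacesOver L v => w'.1.adicCompletion L) w))).charpoly.IsRoot γ := by rw [hcm]; exact hγ
    -- the roots are `≡ 1 (mod ϖ_v²)` (2-deepness of `ι_v(γ_H)_w`, ★ p846644's integral-eigenvalue argument)
    have hfac := charpoly_map_endoEmbLocal_apply L w (γH := γH)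
    have hια : (((((endoEmbLocal L v γH).val : GL (Fin 3) (UnitaryGroup.LocalRing L v)) : Matrix (Fin 3) (Fin 3) (UnitaryGroup.LocalRing L v)).map (Pi.evalRingHom (fun w' : PlacesOver L v => w'.1.adicCompletion L) w))).charpoly.IsRoot α := by
      rw [hfac, Polynomial.IsRoot, eval_mul, hαw.eq_zero, zero_mul]
    have hιγ : (((((endoEmbLocal L v γH).val : GL (Fin 3) (UnitaryGroup.LocalRing L v)) : Matrix (Fin 3) (Fin 3) (UnitaryGroup.LocalRing L v)).map (Pi.evalRingHom (fun w' : PlacesOver L v => w'.1.adicCompletion L) w))).charpoly.IsRoot γ := by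
      rw [hfac, Polynomial.IsRoot, eval_mul, hγw.eq_zero, zero_mul]
    have hdeepι' : ∀ i j, Valued.v (((((endoEmbLocal L v γH).val : GL (Fin 3) (UnitaryGroup.LocalRing L v)) : Matrix (Fin 3) (Fin 3) (UnitaryGroup.LocalRing L v)).map (Pi.evalRingHom (fun w' : PlacesOver L v => w'.1.adicCompletion L) w)) i j - (1 : Matrix (Fin 3) (Fin 3) (w.1.adicCompletion L)) i j) ≤ Valued.v (c w ^ 2) := fun i j => by
      rw [hcc, ← Matrix.sub_apply]; exact hdeepι i j
    have hα2 : Valued.v (α - 1) ≤ WithZero.exp (-2 : ℤ) := by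
      rw [← hcc]; exact valued_sub_one_le_of_isRoot_charpoly_of_congr_one _ hcc0 hdeepι' hια
    have hγ2 : Valued.v (γ - 1) ≤ WithZero.exp (-2 : ℤ) := by
      rw [← hcc]; exact valued_sub_one_le_of_isRoot_charpoly_of_congr_one _ hcc0 hdeepι' hιγ
    have hα1 : Valued.v (α - 1) < 1 := lt_of_le_of_lt hα2 he2
    have hγ1 : Valued.v (γ - 1) < 1 := lt_of_le_of_lt hγ2 he2
    have hb1 : Valued.v (finGammaTwo L v γH w - 1) < 1 := lt_of_le_of_lt hu1e he1
    -- `N ≥ 2`, `N₁, N₂ ≥ 1`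
    have h2N : 2 ≤ N := by
      have h : Valued.v (α - γ) ≤ WithZero.exp (-2 : ℤ) := by
        rw [show α - γ = (α - 1) - (γ - 1) by ring]
        exact (Valuation.map_sub _ _ _).trans (max_le hα2 hγ2)
      rw [hN, WithZero.exp_le_exp] at h; omega
    have hN₁1 : 1 ≤ N₁ := by
      have h : Valued.v (α - finGammaTwo L v γH w) < 1 := by
        rw [show α - finGammaTwo L v γH w = (α - 1) - (finGammaTwo L v γH w - 1) by ring]
        exact lt_of_le_of_lt (Valuation.map_sub _ _ _) (max_lt hα1 hb1)
      rw [hN₁, ← WithZero.exp_zero, WithZero.exp_lt_exp] at h; omega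
    have hN₂1 : 1 ≤ N₂ := by
      have h : Valued.v (γ - finGammaTwo L v γH w) < 1 := by
        rw [show γ - finGammaTwo L v γH w = (γ - 1) - (finGammaTwo L v γH w - 1) by ring]
        exact lt_of_le_of_lt (Valuation.map_sub _ _ _) (max_lt hγ1 hb1)
      rw [hN₂, ← WithZero.exp_zero, WithZero.exp_lt_exp] at h; omega
    -- `|χ_g(u)|_w = exp(−(N₁ + N₂))`
    have Hob6 := trace_det_disc_of_isRoot_of_isRoot (((γH.1.val : GL (Fin 2) (LocalRing L v)).val.map (Pi.evalRingHom (fun w' : PlacesOver L v => w'.1.adicCompletion L) w))) hαw hγw hαγ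
    obtain ⟨htr, hdet, hdisc⟩ := Hob6
    have hn : Valued.v (((finCharpolyTwo L v γH).eval (finGammaTwo L v γH)) w) = WithZero.exp (-((N₁ + N₂ : ℕ) : ℤ)) := by
      rw [eval_finCharpolyTwo_finGammaTwo_apply_eq_quadratic]
      have e : finGammaTwo L v γH w ^ 2 - (((γH.1.val : GL (Fin 2) (LocalRing L v)).val.map (Pi.evalRingHom (fun w' : PlacesOver L v => w'.1.adicCompletion L) w))).trace * finGammaTwo L v γH w + (((γH.1.val : GL (Fin 2) (LocalRing L v)).val.map (Pi.evalRingHom (fun w' : PlacesOver L v => w'.1.adicCompletion L) w))).det =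
          (α - finGammaTwo L v γH w) * (γ - finGammaTwo L v γH w) := by rw [htr, hdet]; ring
      rw [show ((γH.1.val.val : Matrix (Fin 2) (Fin 2) (UnitaryGroup.LocalRing L v)).map
          (Pi.evalRingHom (fun w' : UnitaryGroup.PlacesOver L v => w'.1.adicCompletion L) w)) = (((γH.1.val : GL (Fin 2) (LocalRing L v)).val.map (Pi.evalRingHom (fun w' : PlacesOver L v => w'.1.adicCompletion L) w))) from rfl, e, map_mul, hN₁, hN₂,
        ← WithZero.exp_add]
      congr 1; push_cast; ring
    have hn2 : 2 ≤ N₁ + N₂ := by omega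
    -- the discriminant `(α − γ)²` is `< exp(−2)`
    have hdisclt : Valued.v ((((γH.1.val : GL (Fin 2) (LocalRing L v)).val.map (Pi.evalRingHom (fun w' : PlacesOver L v => w'.1.adicCompletion L) w))).trace ^ 2 - 4 * (((γH.1.val : GL (Fin 2) (LocalRing L v)).val.map (Pi.evalRingHom (fun w' : PlacesOver L v => w'.1.adicCompletion L) w))).det) < WithZero.exp (-2 : ℤ) := by
      rw [hdisc, map_pow, hN, ← WithZero.exp_nsmul, WithZero.exp_lt_exp, two_nsmul]; omega
    -- denominators and the shifted element `u_H = (s₁, s₂)`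
    have Hoc1 :=
      isUnit_shift_denominators_of_disc_lt L v w hw γH hσc hc h2w hg1 hu1 hdisclt
    obtain ⟨-, -, -, -, hU2m, hU2p, hU1s, -, hU1m', hU1p', hU3⟩ := Hoc1
    have Hob7 := exists_local_coe_eq_moebius L v 2 (Matrix.of fun i j : Fin 2 => if i.val + j.val + 1 = 2 then (1 : L) else 0) γH.1 hσc hU2m hU2p
    obtain ⟨s₁, hs₁⟩ := Hob7
    have Hob8 := exists_local_coe_eq_moebius L v 1 (Matrix.of fun i j : Fin 1 => if i.val + j.val + 1 = 1 then (1 : L) else 0) γH.2 hσc hU1m' hU1p'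
    obtain ⟨s₂, hs₂⟩ := Hob8
    have hu'eq := finGammaTwo_of_coe_eq_moebius L v γH (s₁, s₂) c hs₂
    have Hoc2 :=
      shifted_binders_of_typeOne L v w hw γH (s₁, s₂) hσc hc h2w hs₁ hu'eq hg1 hu1 α γ hα hγ hαγ N hN h2N hα2 hγ2 hn2 hn
    obtain ⟨hα', hγ', hαγ', hN', hα1', hγ1', hn', hreg'⟩ := Hoc2
    have hell' := not_levi_of_shift L v γH (s₁, s₂) h4c hs₁ hU2m hnl
    -- the two `S`-rows (★ p846474, type (1))
    have HS := stableOrbitalIntegralRel_chi_shift_of_isRoot L v w hw νH hv hmH hreg hnl α γ hα hγ hαγ N hN hα1 hγ1 hreg' hell'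
      _ _ hα' hγ' hαγ' hN' hα1' hγ1' h2N
    -- compact centralisers of the matching classes of `γ_H` and of `u_H` (★ type-(1) supplier, F0P2-p02 (g12))
    have hcm' : ((((s₁, s₂).1.val : GL (Fin 2) (UnitaryGroup.LocalRing L v)).val.map
        (Pi.evalRingHom (fun w' : PlacesOver L v => w'.1.adicCompletion L) w)).charpoly) =
        ((((s₁, s₂).1.val : GL (Fin 2) (LocalRing L v)) : Matrix (Fin 2) (Fin 2) (LocalRing L v)).charpoly).map
          (Pi.evalRingHom (fun w' : PlacesOver L v => w'.1.adicCompletion L) w) := Matrix.charpoly_map _ _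
    have hsplit' : ∃ x : w.1.adicCompletion L, ((((s₁, s₂).1.val : GL (Fin 2) (UnitaryGroup.LocalRing L v)).val.map
        (Pi.evalRingHom (fun w' : PlacesOver L v => w'.1.adicCompletion L) w)).charpoly).IsRoot x := ⟨_, by rw [hcm']; exact hα'⟩
    have hZ : ∀ x : ((cmDatum L 3 H').Local v), IsLocalNormPair L H' v γH x → CompactSpace (Subgroup.centralizer ({x} : Set ((cmDatum L 3 H').Local v))) :=
      fun x hx => compactSpace_centralizer_of_isLocalNormPair_of_isRoot L v H' w hw hH' hdetH hreg hroot hnl x hx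
    have hZ' : ∀ x : ((cmDatum L 3 H').Local v), IsLocalNormPair L H' v (s₁, s₂) x → CompactSpace (Subgroup.centralizer ({x} : Set ((cmDatum L 3 H').Local v))) :=
      fun x hx => compactSpace_centralizer_of_isLocalNormPair_of_isRoot L v H' w hw hH' hdetH hreg' hsplit' hell' x hx
    -- the transport (★ (A3)) with `hF` = N3
    have hm : WithZero.log (Valued.v (((finCharpolyTwo L v (s₁, s₂)).eval (finGammaTwo L v (s₁, s₂))) w)) =
        WithZero.log (Valued.v (((finCharpolyTwo L v γH).eval (finGammaTwo L v γH)) w)) + 2 := by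
      rw [hn', hn, WithZero.log_exp, WithZero.log_exp]; push_cast; omega
    refine ⟨(s₁, s₂), H5 γH (s₁, s₂) hgj' huj' hU2m hU1s hs₁ hu'eq, hreg', ?_, ?_, ?_⟩
    · exact (HS (fun _ => inferInstance) (fun _ => inferInstance)).1
    · exact (HS (fun _ => inferInstance) (fun _ => inferInstance)).2
    exact finsum_finExplicitCollection_Δ_mul_eq_inv_sq_mul_finsum_shift L v H' w hw c γH (s₁, s₂) μ hμω hv hμ hσc h4c hreg hreg'
      hs₁ hs₂ hU2m hU1m' hU3 (hN3_of hU2p hU1p') hU1s hm _ _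
      (fun x y hx hy => classOrbitalIntegral_levelOneIndicator_eq_shift L H' hH' hdetH w hw hv h2w νG hmG c hcw γH (s₁, s₂) hreg hreg' hs₁ hs₂ hU2m hU1m'
        hdeepN3 hZ hZ' g hg hgK hginv c' hc' g' hg's hg'K hg'inv hg'c x y hx hy)
  · /- ───── TYPE (2): `χ_{g_w}` irreducible over `L_w` ───── -/
    have Hob11 := exists_irredExponents_of_hint L v w hw γH hv h2V hintV hroot
    obtain ⟨n, N, M, hn, hN, hlaw⟩ := Hob11
    have Hob12 := valuation_quadratic_bounds_of_entrywise_deep (((γH.1.val : GL (Fin 2) (LocalRing L v)).val.map (Pi.evalRingHom (fun w' : PlacesOver L v => w'.1.adicCompletion L) w))) (finGammaTwo L v γH w) hg1e hu1e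
    obtain ⟨hχ, hdisc, htr, hdet⟩ := Hob12
    have hn2 : 2 ≤ n := by
      rw [← eval_finCharpolyTwo_finGammaTwo_apply_eq_quadratic, hn, WithZero.exp_le_exp] at hχ
      omega
    have hN1 : 1 ≤ N := by
      rw [hN, WithZero.exp_le_exp] at hdisc
      omega
    -- `N ≥ 2` from 2-deepness: `tr² − 4det = (a − d)² + 4bc` is `≤ |ϖ²|²`
    have h2N : 2 ≤ N := by
      have hb : ∀ i j, Valued.v (((((γH.1.val : GL (Fin 2) (LocalRing L v)).val.map (Pi.evalRingHom (fun w' : PlacesOver L v => w'.1.adicCompletion L) w))) - 1) i j) ≤ WithZero.exp (-2 : ℤ) := fun i j => by rw [← hcc]; exact hg2w i j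
      have h4 : Valued.v (4 : w.1.adicCompletion L) ≤ 1 := by
        rw [show (4 : w.1.adicCompletion L) = 2 * 2 by norm_num, map_mul, h2w, one_mul]
      have e : (((γH.1.val : GL (Fin 2) (LocalRing L v)).val.map (Pi.evalRingHom (fun w' : PlacesOver L v => w'.1.adicCompletion L) w))).trace ^ 2 - 4 * (((γH.1.val : GL (Fin 2) (LocalRing L v)).val.map (Pi.evalRingHom (fun w' : PlacesOver L v => w'.1.adicCompletion L) w))).det =
          (((((γH.1.val : GL (Fin 2) (LocalRing L v)).val.map (Pi.evalRingHom (fun w' : PlacesOver L v => w'.1.adicCompletion L) w))) - 1) 0 0 - ((((γH.1.val : GL (Fin 2) (LocalRing L v)).val.map (Pi.evalRingHom (fun w' : PlacesOver L v => w'.1.adicCompletion L) w))) - 1) 1 1) ^ 2 + 4 * (((((γH.1.val : GL (Fin 2) (LocalRing L v)).val.map (Pi.evalRingHom (fun w' : PlacesOver L v => w'.1.adicCompletion L) w))) - 1) 0 1 * ((((γH.1.val : GL (Fin 2) (LocalRing L v)).val.map (Pi.evalRingHom (fun w' : PlacesOver L v => w'.1.adicCompletion L) w))) - 1) 1 0)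 := by
        simp only [Matrix.trace_fin_two, Matrix.det_fin_two, Matrix.sub_apply, Matrix.one_apply_eq, Matrix.one_apply_ne (by decide : (0 : Fin 2) ≠ 1),
          Matrix.one_apply_ne (by decide : (1 : Fin 2) ≠ 0)]
        ring
      have h : Valued.v ((((γH.1.val : GL (Fin 2) (LocalRing L v)).val.map (Pi.evalRingHom (fun w' : PlacesOver L v => w'.1.adicCompletion L) w))).trace ^ 2 - 4 * (((γH.1.val : GL (Fin 2) (LocalRing L v)).val.map (Pi.evalRingHom (fun w' : PlacesOver L v => w'.1.adicCompletion L) w))).det) ≤ WithZero.exp (-4 : ℤ) := by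
        rw [e]
        refine (Valuation.map_add _ _ _).trans (max_le ?_ ?_)
        · rw [map_pow, show (-4 : ℤ) = 2 • (-2 : ℤ) by norm_num, WithZero.exp_nsmul]
          exact pow_le_pow_left' ((Valuation.map_sub _ _ _).trans (max_le (hb 0 0) (hb 1 1))) 2
        · rw [map_mul, map_mul, show WithZero.exp (-4 : ℤ) = 1 * (WithZero.exp (-2 : ℤ) * WithZero.exp (-2 : ℤ)) by
            rw [← WithZero.exp_add, one_mul]; norm_num]
          exact mul_le_mul' h4 (mul_le_mul' (hb 0 1) (hb 1 0))
      rw [hN, WithZero.exp_le_exp] at h; omega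
    have htr' : Valued.v ((((γH.1.val : GL (Fin 2) (LocalRing L v)).val.map (Pi.evalRingHom (fun w' : PlacesOver L v => w'.1.adicCompletion L) w))).trace - 2) < 1 := lt_of_le_of_lt htr he1
    have hdet' : Valued.v ((((γH.1.val : GL (Fin 2) (LocalRing L v)).val.map (Pi.evalRingHom (fun w' : PlacesOver L v => w'.1.adicCompletion L) w))).det - 1) < 1 := lt_of_le_of_lt hdet he1
    -- denominators and the shifted element `u_H = (s₁, s₂)`
    have Hoc3 :=
      isUnit_shift_denominators_of_typeTwo L v w hw γH hσc hc h2w hg1 hu1 hN1 hN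
    obtain ⟨hw2m, -, hw1m, -, hU2m, hU2p, hU1s, -, hU1m', hU1p', hU3⟩ := Hoc3
    have Hob13 := exists_local_coe_eq_moebius L v 2 (Matrix.of fun i j : Fin 2 => if i.val + j.val + 1 = 2 then (1 : L) else 0) γH.1 hσc hU2m hU2p
    obtain ⟨s₁, hs₁⟩ := Hob13
    have Hob14 := exists_local_coe_eq_moebius L v 1 (Matrix.of fun i j : Fin 1 => if i.val + j.val + 1 = 1 then (1 : L) else 0) γH.2 hσc hU1m' hU1p'
    obtain ⟨s₂, hs₂⟩ := Hob14
    have hu'eq := finGammaTwo_of_coe_eq_moebius L v γH (s₁, s₂) c hs₂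
    have Hob15 := shifted_binders_of_typeTwo L v w hw γH (s₁, s₂) hσc hc h2w hs₁ hu'eq hg1 hu1 hroot hn2 hN1 hn hN
    obtain ⟨hN', hn', hirr', hreg'⟩ := Hob15
    have hint' := charpoly_coeff_endoEmbLocal_mem_of_shifted L v w hw γH (s₁, s₂) hσc hc h2w hs₁ hu'eq hg1 hu1 hN1 hN
    haveI := compactSpace_centralizer_of_not_exists_isRoot L v w hw hv γH h2 hint hroot N hN
    haveI := compactSpace_centralizer_of_not_exists_isRoot L v w hw hv (s₁, s₂) h2 hint' hirr' (N - 1) hN'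
    -- level-1 bounds for `u_H` (★ N5a with `j = 1`)
    have hs₁w : (((s₁, s₂).1.val : GL (Fin 2) (LocalRing L v)).val.map (Pi.evalRingHom (fun w' : PlacesOver L v => w'.1.adicCompletion L) w)) =
        ((c w + 1) • (((γH.1.val : GL (Fin 2) (LocalRing L v)).val.map (Pi.evalRingHom (fun w' : PlacesOver L v => w'.1.adicCompletion L) w))) + (c w - 1) • (1 : Matrix (Fin 2) (Fin 2) (w.1.adicCompletion L))) *
          ((c w - 1) • (((γH.1.val : GL (Fin 2) (LocalRing L v)).val.map (Pi.evalRingHom (fun w' : PlacesOver L v => w'.1.adicCompletion L) w))) + (c w + 1) • (1 : Matrix (Fin 2) (Fin 2) (w.1.adicCompletion L)))⁻¹ := by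
      rw [show (s₁, s₂).1 = s₁ from rfl, hs₁, map_moebius (Pi.evalRingHom (fun w' : PlacesOver L v => w'.1.adicCompletion L) w) _ _ _ hU2m, map_add, map_sub, map_one]
      rfl
    have hs₂w : finGammaTwo L v (s₁, s₂) w = ((c w + 1) * finGammaTwo L v γH w + (c w - 1)) / ((c w - 1) * finGammaTwo L v γH w + (c w + 1)) := by
      have hmul : finGammaTwo L v (s₁, s₂) * ((c - 1) * finGammaTwo L v γH + (c + 1)) = (c + 1) * finGammaTwo L v γH + (c - 1) := by
        rw [hu'eq, mul_assoc, Ring.inverse_mul_cancel _ hU1s, mul_one]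
      have hmw := congrFun hmul w
      simp only [Pi.mul_apply, Pi.add_apply, Pi.sub_apply, Pi.one_apply] at hmw
      have hne : (c w - 1) * finGammaTwo L v γH w + (c w + 1) ≠ 0 := fun h => by
        have e : ((c - 1) * finGammaTwo L v γH + (c + 1)) w = (c w - 1) * finGammaTwo L v γH w + (c w + 1) := rfl
        rw [e, h, map_zero] at hw1m; exact WithZero.zero_ne_coe hw1m
      rw [eq_div_iff hne]
      exact hmw
    have Hob16 := valued_moebius_sub_one_le_of_level h2w hc (((γH.1.val : GL (Fin 2) (LocalRing L v)).val.map (Pi.evalRingHom (fun w' : PlacesOver L v => w'.1.adicCompletion L) w))) (j := 1) le_rfl hg2c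
    obtain ⟨hg1u, -⟩ := Hob16
    have Hob17 := valued_moebius_scalar_sub_one_le_of_level h2w hc (finGammaTwo L v γH w) (j := 1) le_rfl hu2c
    obtain ⟨hu1u, -⟩ := Hob17
    rw [pow_one, ← hs₁w] at hg1u
    rw [pow_one, ← hs₂w] at hu1u
    have hg1u' : ∀ i j, Valued.v (((((s₁, s₂).1.val : GL (Fin 2) (LocalRing L v)).val.map (Pi.evalRingHom (fun w' : PlacesOver L v => w'.1.adicCompletion L) w)) - 1) i j) ≤ WithZero.exp (-1 : ℤ) :=
      fun i j => by rw [← hc]; exact hg1u i j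
    have hu1u' : Valued.v (finGammaTwo L v (s₁, s₂) w - 1) ≤ WithZero.exp (-1 : ℤ) := by rw [← hc]; exact hu1u
    have Hob18 := valuation_quadratic_bounds_of_entrywise_deep _ _ hg1u' hu1u'
    obtain ⟨-, -, htru, hdetu⟩ := Hob18
    have htru' : Valued.v ((((s₁, s₂).1.val : GL (Fin 2) (LocalRing L v)).val.map (Pi.evalRingHom (fun w' : PlacesOver L v => w'.1.adicCompletion L) w)).trace - 2) < 1 := lt_of_le_of_lt htru he1
    have hdetu' : Valued.v ((((s₁, s₂).1.val : GL (Fin 2) (LocalRing L v)).val.map (Pi.evalRingHom (fun w' : PlacesOver L v => w'.1.adicCompletion L) w)).det - 1) < 1 := lt_of_le_of_lt hdetu he1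
    -- the two `S`-rows (★ p846474, type (2))
    have HS := stableOrbitalIntegralRel_chi_shift_of_not_exists_isRoot L v w hw νH hv hmH h2 hreg hint hroot N hN htr' hdet' hreg' hint' hirr'
      hN' htru' hdetu' h2N
    -- compact centralisers of the matching classes (★ anisotropic torus)
    have hZ : ∀ x : ((cmDatum L 3 H').Local v), IsLocalNormPair L H' v γH x → CompactSpace (Subgroup.centralizer ({x} : Set ((cmDatum L 3 H').Local v))) := fun x hx =>
      compactSpace_centralizer_of_isLocalNormPair_of_not_exists_isRoot L v w hw hH'u hv hreg h2 hint hroot N hN x hx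
    have hZ' : ∀ x : ((cmDatum L 3 H').Local v), IsLocalNormPair L H' v (s₁, s₂) x → CompactSpace (Subgroup.centralizer ({x} : Set ((cmDatum L 3 H').Local v))) := fun x hx =>
      compactSpace_centralizer_of_isLocalNormPair_of_not_exists_isRoot L v w hw hH'u hv hreg' h2 hint' hirr' (N - 1) hN' x hx
    -- the transport (★ (A3)) with `hF` = N3
    have hm : WithZero.log (Valued.v (((finCharpolyTwo L v (s₁, s₂)).eval (finGammaTwo L v (s₁, s₂))) w)) =
        WithZero.log (Valued.v (((finCharpolyTwo L v γH).eval (finGammaTwo L v γH)) w)) + 2 := by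
      rw [hn', hn, WithZero.log_exp, WithZero.log_exp]; omega
    refine ⟨(s₁, s₂), H5 γH (s₁, s₂) hgj' huj' hU2m hU1s hs₁ hu'eq, hreg', ?_, ?_, ?_⟩
    · exact (HS (fun _ => inferInstance) (fun _ => inferInstance)).1
    · exact (HS (fun _ => inferInstance) (fun _ => inferInstance)).2
    exact finsum_finExplicitCollection_Δ_mul_eq_inv_sq_mul_finsum_shift L v H' w hw c γH (s₁, s₂) μ hμω hv hμ hσc h4c hreg hreg'
      hs₁ hs₂ hU2m hU1m' hU3 (hN3_of hU2p hU1p') hU1s hm _ _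
      (fun x y hx hy => classOrbitalIntegral_levelOneIndicator_eq_shift L H' hH' hdetH w hw hv h2w νG hmG c hcw γH (s₁, s₂) hreg hreg' hs₁ hs₂ hU2m hU1m'
        hdeepN3 hZ hZ' g hg hgK hginv c' hc' g' hg's hg'K hg'inv hg'c x y hx hy)

end Literature.NumberTheory.Rogawski1990

end
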